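import Summits.CriticalPhenomena.PercolationContinuityZ3.Theses.PercNearOneGluing
import Literature.Probability.Percolation.PercolationProofs

/-!
# Line `subuniform-dead-pocket-maximum` — skeleton for the crux `PercNearOneGluing.AdditiveGluing`
(crux item stmt-CriticalPhenomena-4576, route `route-CriticalPhenomena-PercNearOneGluing`, rank 5; idea card
`subuniform-dead-pocket-maximum` (ideator 1, round 1; triage r1 k = 1, 2, 3: pass / pass / pass, each "with doubt:
name the load-bearing averaged inequality"); crux-plan by
planner-cruxplan-stmt-CriticalPhenomena-4576-subuniform-dead-pock-0, 2026-08-16.)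

Crux (FIXED, by name): `AdditiveGluing` —
`∀ n w A o b t, 0 ≤ t → (∀ a ∈ A, 1 - t ≤ P(a ↔ b)) → P(o ↔ A) - t ≤ P(o ↔ b)` for the product Bernoulli measure
`prodBernoulli w` on bond configurations of the complete weighted graph on `Fin n`
(`Literature.Probability.LatticeModels.prodBernoulli`, events `Literature.Probability.Percolation.openConn`).

Notation in the docstrings: `μ = prodBernoulli w`; `τ(x) = μ(x ↔ b)`; for a vertex set `W`,
`τ_{G−W}(x) = μ(x ↔ b in Wᶜ) = μ(openConnIn Wᶜ x b)` (connection avoiding `W`; equals the two-point function of the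
graph with `W` deleted); `C(o) = openCluster · o`; the LIVE FAILURE `Φ(A) = μ(o ↔ A, o ↮ b)`; the DEAD POCKETS of `o`
relative to `A` are the values `W` of `C(o)` with `W ∩ A = ∅`.

## The line in one paragraph
Level-set normal form (KN §5.6(4), exact): `AdditiveGluing` ⟸ for every level `s`, with `A_s = {x : τ(x) ≥ 1 − t}`,
`Φ(A_s) ≤ t`, i.e. the dead-pocket maximum `M⁻ = 1{o ↮ b}·max_{C(o)} τ` is sub-uniform (the idea card). The load-bearing
statement of the line is the PENALISED form of this sub-uniformity — Kozma–Nitzan's "good quadruple" inequality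
(arXiv:2401.12397 §3.2, p.12), asked here for ALL quadruples:
  `GOOD(G,A,o,b):  Φ(A) + Σ_{W dead pocket} μ(C(o) = W) · max_{a ∈ A} (1 − τ_{G−W}(a)) ≤ max_{a ∈ A} (1 − τ(a))`
("live failure + penalised dead-pocket maximum ≤ worst relay failure"; KN's form: `P(o↔b) ≥ min_a τ(a) −
Σ_{W∩A=∅} P(C(o)=W) min_a P_{G∖W}(a↔b)`). KN prove it when `o` is isolated in `G ∖ A` (Thm 4) and one layer beyond
(Thm 5), by the `σ_B`-decomposition at `o` + their BHK Lemma 5; GOOD ⟹ pre-FKG (2) ⟹ Question 7 ⟹ SAG ⟹ AG (KN p.12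
and this file's composition, which only needs to DROP the nonnegative penalty). Why this and not a weaker budget:
the planner's exact-enumeration lab (line card §Numerics; witnesses `pocket-witnesses.md`) REFUTES every inequality that
cashes the per-pocket currency `min_a τ_{G−W}` against the global level `1 − s` (max-over-attachable budgets, the
`G−W`-minimiser budget, the re-ordering budget, the additive drift budget, pocketwise Q7 on re-ordering pockets — all
false on 5 vertices while the crux holds with 40 % room), whereas GOOD — the statement that KEEPS that currency inside
the dead-pocket sum — has 0 violations in ≈ 3·10⁴ exact (o, b, level) instances on ≤ 6 vertices (level sets and
general `A ∋ b`; kit j007792 extends to 7). The skeleton files GOOD as an INDUCTION on the number of positive-degree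
vertices: the BHK lever is KN's Lemma 5 for an arbitrary relay point (stub 1, in print); base = KN Thm 4's class,
derived from Lemma 5 (stub 2, in print); step = goodness propagates to an observer with a low neighbour from all
weight functions with fewer positive-degree vertices (stub 3, HARDEST; KN Thm 5 is its first instance; the instances
the `σ_B`-recursion actually consumes are `w` with the pairs at `o` zeroed — observer a low neighbour `x` — and the
same with a weight-1 clique on a low branch `B ⊆ N(o)`, `|B| ≥ 2`, observer in `B`). The composition `AdditiveGluing_of`
is a real proof: strong induction (`good_all`) + the level-set reduction + dropping the penalty.

GOOD is written below in LINEAR "selection form": for every selection `sel : Finset (Fin n) → Fin n` of a relay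
`sel W ∈ A` per pocket and every admissible level `t` (`1 − t ≤ τ(a)` on `A`), `Φ(A) + Σ_W μ(C(o)=W)·μ((sel W ↔ b in
Wᶜ)ᶜ) ≤ t`; quantifying over all selections is the `max` inside the sum, and `t ≥ max_a (1 − τ(a))` is the outer max.
-/

namespace Summit.CriticalPhenomena.PercolationContinuityZ3.Cruxes.AdditiveGluing.SubuniformDeadPocketMaximum

open MeasureTheory Literature.Probability.LatticeModels Literature.Probability.Percolation
open scoped Classical BigOperators

/-! ## Stub 1 — the BHK lever: Kozma–Nitzan Lemma 5 for an ARBITRARY relay point -/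

/-- STUB 1 (size L; TRUE in print: Kozma–Nitzan arXiv:2401.12397 Lemma 5 p.13, via Lemma 3(i) p.6–7 and Lemma 1
p.5–6, whose input is the van den Berg–Häggström–Kahn conditional association inequality (BHK 2006 =
doi:10.1002/rsa.20102, Thms 1.2/1.4, "f, g increasing, defined on the cluster of A, conditioned on A ↮ B"; the
tree holds only the one-vertex Thm 1.3 as the NAMED FACT
`Literature.Probability.Percolation.BHK2006_clusterConditionalPositiveAssociation` — the set version is not vendored)
plus Harris (`Literature.Probability.LatticeModels.prodBernoulli_harris`). Generalisation checked by triage r1-2/r1-3: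
KN's proof never uses that `a` is a neighbour of `0`, nor that `B ⊆ A`. This is where the line spends
edge-independence (the shared-bit barrier note `Cruxes/NearOneGluing/BarrierSharedBit.md`): Lemma 5 is false in
the shared-bit model and for oriented percolation.)
**Lemma 5, any relay.** Let `o ≠ b`, `a ≠ o`, `B ∌ o` a finite set of vertices with `v ∈ B`, and suppose `a` is at
most as reliable as `v` OFF `o`: `μ(a ↔ b in {o}ᶜ) ≤ μ(v ↔ b in {o}ᶜ)`. Let `σ_B` be the event "the pairs `o–y`,
`y ∈ B`, are open and all other pairs at `o` are closed" (KN's `σ_B`; if some `y ∈ B` has `w s(o,y) = 0` the event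
is null and the claim trivial). Then `μ(σ_B ∩ {a ↔ b}) ≤ μ(σ_B ∩ {o ↔ b})` (equality if `a ∈ B`). Proof route (KN):
auxiliary weights `ε` on `o–B`, `0` elsewhere at `o`; `E = {o–B open}` is increasing in the cluster of `v`; Lemma 3(i)
transports `τ_H(a) ≤ τ_H(v) + ε|B|` through the conditioning on `E`; let `ε → 0`; under `σ_B`, `v ↔ b ⟺ o ↔ b`.
Planner's exact check of THIS generalised form: 0 violations in 4.8·10⁵ `(a, v, B)` tests on ≤ 5 vertices
(lab/lemma5check.py), after the triagers' 1.2·10⁶ + 4·10⁴. -/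
theorem stub_lemma5AnyRelay :
    ∀ (n : ℕ) (w : Sym2 (Fin n) → unitInterval) (o b a v : Fin n) (B : Finset (Fin n)),
      b ≠ o → a ≠ o → o ∉ B → v ∈ B →
      (prodBernoulli w).real (openConnIn (({o} : Set (Fin n))ᶜ) a b)
        ≤ (prodBernoulli w).real (openConnIn (({o} : Set (Fin n))ᶜ) v b) →
      (prodBernoulli w).real
          ({ω : BondConfig (Fin n) | ∀ y : Fin n, y ≠ o → (s(o, y) ∈ ω ↔ y ∈ B)} ∩ openConn a b)
        ≤ (prodBernoulli w).real
          ({ω : BondConfig (Fin n) | ∀ y : Fin n, y ≠ o → (s(o, y) ∈ ω ↔ y ∈ B)} ∩ openConn o b) := by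
  sorry

/-! ## Stub 2 — base of the induction: KN Theorem 4's class (observer isolated in `G ∖ A`), from Lemma 5 -/

/-- STUB 2 (size M–L; TRUE in print: Kozma–Nitzan arXiv:2401.12397 Theorem 4 p.12–14, the summation of Lemma 5 over
the events `σ_B`; tree tools: the `σ_B` (`B ⊆ univ ∖ {o}`) partition the configuration space by the open star of
`o`; `{C(o) = {o}} = σ_∅`; independence of `σ_∅` (determined by the pairs at `o`) from events in `{o}ᶜ`
(`Literature.Probability.LatticeModels.prodBernoulli_real_inter_of_determinedBy_disjoint`); on `{C(o) = W}` with
`W ∌ a, b`, `a ↔ b ⟺ a ↔ b in Wᶜ`; weight-0 pairs are a.s. closed (`prodBernoulli_ae_notMem`)).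
**Goodness when the observer has no low neighbour, given Lemma 5.** Assume the statement of `stub_lemma5AnyRelay`
(displayed hypothesis). If every positive-weight pair at `o` goes into `A` (KN: "`0` is isolated in `G ∖ A`"; the
loop `s(o,o)` may carry any weight, it never opens an adjacency, `openGraph_adj`), then `GOOD(w, A, o, b)`.
Proof route: with `a₀ := argmin_{a ∈ A} τ_{G−{o}}(a)`, Lemma 5 for every `B ≠ ∅` with `μ(σ_B) > 0` (then `B ⊆ A`,
take `v ∈ B`) summed over `B` gives `P(a₀ ↔ b, o ↔ A) ≤ P(o ↔ b)`; hence
`Φ(A) = P(o ↔ A) − P(o ↔ b) ≤ P(o ↔ A) − τ(a₀) + P(σ_∅)·τ_{G−{o}}(a₀) ≤ t − P(σ_∅)·(1 − τ_{G−{o}}(a₀))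
 ≤ t − P(C(o) = {o})·(1 − τ_{G−{o}}(sel {o}))`, while every other dead pocket `W ∋ y ≠ o` needs an open pair `o–y`
with `y ∉ A`, a null event. Includes the degenerate `o` with no positive-weight pair at all. -/
theorem stub_goodBase :
    (∀ (n : ℕ) (w : Sym2 (Fin n) → unitInterval) (o b a v : Fin n) (B : Finset (Fin n)),
      b ≠ o → a ≠ o → o ∉ B → v ∈ B →
      (prodBernoulli w).real (openConnIn (({o} : Set (Fin n))ᶜ) a b)
        ≤ (prodBernoulli w).real (openConnIn (({o} : Set (Fin n))ᶜ) v b) →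
      (prodBernoulli w).real
          ({ω : BondConfig (Fin n) | ∀ y : Fin n, y ≠ o → (s(o, y) ∈ ω ↔ y ∈ B)} ∩ openConn a b)
        ≤ (prodBernoulli w).real
          ({ω : BondConfig (Fin n) | ∀ y : Fin n, y ≠ o → (s(o, y) ∈ ω ↔ y ∈ B)} ∩ openConn o b)) →
    ∀ (n : ℕ) (w : Sym2 (Fin n) → unitInterval) (A : Finset (Fin n)) (o b : Fin n),
      b ∈ A → o ∉ A →
      (∀ y : Fin n, y ∉ A → y ≠ o → (w s(o, y) : ℝ) = 0) →
      ∀ (t : ℝ) (sel : Finset (Fin n) → Fin n), (∀ W, sel W ∈ A) →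
        (∀ a ∈ A, 1 - t ≤ (prodBernoulli w).real (openConn a b)) →
        (prodBernoulli w).real ((⋃ a ∈ A, openConn o a) ∩ (openConn o b)ᶜ)
          + ∑ W ∈ (Finset.univ : Finset (Finset (Fin n))).filter (fun W => o ∈ W ∧ Disjoint W A),
              (prodBernoulli w).real {ω : BondConfig (Fin n) | openCluster ω o = (W : Set (Fin n))}
                * (prodBernoulli w).real (openConnIn ((W : Set (Fin n))ᶜ) (sel W) b)ᶜ
          ≤ t := by
  sorry

/-! ## Stub 3 — HARDEST: goodness propagates (the inductive step; KN Theorem 5 is its first instance) -/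

/-- STUB 3 — HARDEST (open; sources: Kozma–Nitzan arXiv:2401.12397 §3.2 Definition "good" p.12, Theorem 5 p.13–14
(the step when `N(o) ⊆ A ∪ {x}`), Questions 7–9 p.36; planner's lab (line card §Numerics): GOOD has 0 violations in
≈ 3·10⁴ exact instances n ≤ 6, the five weaker pocket budgets are refuted; triage r1-1/r1-2 on the sibling card
`sigma-recursion-lemma5-any-relay`: the `|B| ≥ 2` low branches re-order the worst relay under gluing — the locus of
the difficulty here too).
**Inductive step.** Let `o ∉ A ∋ b` and suppose `o` HAS a low neighbour (`∃ y ∉ A, y ≠ o, w s(o,y) ≠ 0`). Assume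
GOOD for every weight function `w'` on the same vertex set with FEWER positive-degree vertices
(`#{v | ∃ u, 0 < w' s(u,v)} < #{v | ∃ u, 0 < w s(u,v)}`) and all `A', o', b'` with `b' ∈ A'`, `o' ∉ A'`. Then
`GOOD(w, A, o, b)`. The instances KN's recursion consumes are all of this kind: `w⁰` = `w` with every edge at `o` set
to `0` (observer: a low neighbour `x`; `o` drops out of the positive-degree set), and `w⁰ + K_B` = the same with
weight `1` on the pairs inside a low branch `B ⊆ N(o) ∖ A`, `|B| ≥ 2` (observer: any vertex of `B`; "contraction =
weight-1 edges", KN §4) — conditioning on `σ_B` (exactly the edges `o–B` open at `o`) IS percolation on `w⁰ + K_B`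
for every connection not through `o`. Proof burden beyond KN: for `|B| ≥ 2` the glued graph's minimiser of
`τ` may differ from the `τ_{G−{o}}`-minimiser `a₀` used in the `A`-touching branches (re-ordering by gluing), so the
branch bounds `P(o ↔ b, σ_B) ≥ P(a_B ↔ b, σ_B) − corr_B` come with branch-dependent relays `a_B` and must be
re-assembled against `min_a Σ_B P(a ↔ b, σ_B)`; the dead-pocket penalty (with `min_a τ_{G−W}` INSIDE the sum over
pockets `W ⊇ B ∪ {o}`) is the book-keeping device that absorbs exactly the `G−W` currency Lemma 5 produces — the
planner's refuted budgets show that no fixed-level currency does. Why it might fail: GOOD is stronger than KN's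
Question 7 (which KN call "rather hesitant"); a gadget in which a likely dead pocket `W` of `o` is a bottleneck for a
RELIABLE relay far from `o` would inflate the penalty — none found (such relays have `τ < τ(o)` and fall out of every
level set; for general `A` they inflate the right-hand side as much). -/
theorem stub_goodStep :
    ∀ (n : ℕ) (w : Sym2 (Fin n) → unitInterval) (A : Finset (Fin n)) (o b : Fin n),
      b ∈ A → o ∉ A →
      (∃ y : Fin n, y ∉ A ∧ y ≠ o ∧ (w s(o, y) : ℝ) ≠ 0) →
      (∀ w' : Sym2 (Fin n) → unitInterval,
        (Finset.univ.filter (fun v : Fin n => ∃ u : Fin n, 0 < (w' s(u, v) : ℝ))).card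
          < (Finset.univ.filter (fun v : Fin n => ∃ u : Fin n, 0 < (w s(u, v) : ℝ))).card →
        ∀ (A' : Finset (Fin n)) (o' b' : Fin n), b' ∈ A' → o' ∉ A' →
        ∀ (t : ℝ) (sel : Finset (Fin n) → Fin n), (∀ W, sel W ∈ A') →
          (∀ a ∈ A', 1 - t ≤ (prodBernoulli w').real (openConn a b')) →
          (prodBernoulli w').real ((⋃ a ∈ A', openConn o' a) ∩ (openConn o' b')ᶜ)
            + ∑ W ∈ (Finset.univ : Finset (Finset (Fin n))).filter (fun W => o' ∈ W ∧ Disjoint W A'),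
                (prodBernoulli w').real {ω : BondConfig (Fin n) | openCluster ω o' = (W : Set (Fin n))}
                  * (prodBernoulli w').real (openConnIn ((W : Set (Fin n))ᶜ) (sel W) b')ᶜ
            ≤ t) →
      ∀ (t : ℝ) (sel : Finset (Fin n) → Fin n), (∀ W, sel W ∈ A) →
        (∀ a ∈ A, 1 - t ≤ (prodBernoulli w).real (openConn a b)) →
        (prodBernoulli w).real ((⋃ a ∈ A, openConn o a) ∩ (openConn o b)ᶜ)
          + ∑ W ∈ (Finset.univ : Finset (Finset (Fin n))).filter (fun W => o ∈ W ∧ Disjoint W A),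
              (prodBernoulli w).real {ω : BondConfig (Fin n) | openCluster ω o = (W : Set (Fin n))}
                * (prodBernoulli w).real (openConnIn ((W : Set (Fin n))ᶜ) (sel W) b)ᶜ
          ≤ t := by
  sorry

/-! ## Goodness of every quadruple, by strong induction on the number of positive-degree vertices -/

/-- **Every quadruple is good** (`b ∈ A`, `o ∉ A`): strong induction on `#{v | ∃ u, 0 < w s(u,v)}`, base `stub_goodBase`
(no low neighbour at `o`), step `stub_goodStep`. Real proof. -/
theorem good_all (n : ℕ) :
    ∀ (w : Sym2 (Fin n) → unitInterval) (A : Finset (Fin n)) (o b : Fin n),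
      b ∈ A → o ∉ A →
      ∀ (t : ℝ) (sel : Finset (Fin n) → Fin n), (∀ W, sel W ∈ A) →
        (∀ a ∈ A, 1 - t ≤ (prodBernoulli w).real (openConn a b)) →
        (prodBernoulli w).real ((⋃ a ∈ A, openConn o a) ∩ (openConn o b)ᶜ)
          + ∑ W ∈ (Finset.univ : Finset (Finset (Fin n))).filter (fun W => o ∈ W ∧ Disjoint W A),
              (prodBernoulli w).real {ω : BondConfig (Fin n) | openCluster ω o = (W : Set (Fin n))}
                * (prodBernoulli w).real (openConnIn ((W : Set (Fin n))ᶜ) (sel W) b)ᶜ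
          ≤ t := by
  suffices h : ∀ (k : ℕ) (w : Sym2 (Fin n) → unitInterval),
      (Finset.univ.filter (fun v : Fin n => ∃ u : Fin n, 0 < (w s(u, v) : ℝ))).card = k →
      ∀ (A : Finset (Fin n)) (o b : Fin n), b ∈ A → o ∉ A →
      ∀ (t : ℝ) (sel : Finset (Fin n) → Fin n), (∀ W, sel W ∈ A) →
        (∀ a ∈ A, 1 - t ≤ (prodBernoulli w).real (openConn a b)) →
        (prodBernoulli w).real ((⋃ a ∈ A, openConn o a) ∩ (openConn o b)ᶜ)
          + ∑ W ∈ (Finset.univ : Finset (Finset (Fin n))).filter (fun W => o ∈ W ∧ Disjoint W A),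
              (prodBernoulli w).real {ω : BondConfig (Fin n) | openCluster ω o = (W : Set (Fin n))}
                * (prodBernoulli w).real (openConnIn ((W : Set (Fin n))ᶜ) (sel W) b)ᶜ
          ≤ t by
    intro w A o b hb ho
    exact h _ w rfl A o b hb ho
  intro k
  induction k using Nat.strong_induction_on with
  | _ k ih =>
    intro w hk A o b hb ho
    by_cases hiso : ∀ y : Fin n, y ∉ A → y ≠ o → (w s(o, y) : ℝ) = 0
    · exact stub_goodBase stub_lemma5AnyRelay n w A o b hb ho hiso
    · push Not at hiso
      refine stub_goodStep n w A o b hb ho hiso ?_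
      intro w' hw' A' o' b' hb' ho'
      exact ih _ (hk ▸ hw') w' rfl A' o' b' hb' ho'

/-! ## The composition: level-set normal form + goodness ⟹ the crux BY NAME -/

/-- **`AdditiveGluing` from the line `subuniform-dead-pocket-maximum`.** Real proof: if `t ≥ 1` the claim is
`μ(o ↔ A) − t ≤ 0 ≤ μ(o ↔ b)`. Otherwise pass to the LEVEL SET `A' = {x | 1 − t ≤ τ(x)} ⊇ A`, which contains `b`
(`τ(b) = 1`). If `o ∈ A'` then `μ(o ↔ A) − t ≤ 1 − t ≤ τ(o)`. If `o ∉ A'`, goodness of `(w, A', o, b)` (`good_all`,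
with the constant selection `b`) bounds the live failure `μ(o ↔ A', o ↮ b)` by `t` after dropping the nonnegative
dead-pocket penalty, and `{o ↔ A} ⊆ {o ↔ A', o ↮ b} ∪ {o ↔ b}` finishes. -/
theorem AdditiveGluing_of :
    Summit.CriticalPhenomena.PercolationContinuityZ3.Theses.PercNearOneGluing.AdditiveGluing := by
  intro n w A o b t ht hA
  have hU1 : (prodBernoulli w).real (⋃ a ∈ A, (openConn o a : Set (BondConfig (Fin n)))) ≤ 1 :=
    measureReal_le_one
  have hob0 : 0 ≤ (prodBernoulli w).real (openConn o b : Set (BondConfig (Fin n))) := measureReal_nonneg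
  by_cases ht1 : 1 ≤ t
  · linarith
  push Not at ht1
  -- the level set at level 1 - t
  have hbb : (prodBernoulli w).real (openConn b b : Set (BondConfig (Fin n))) = 1 := by
    have h : (openConn b b : Set (BondConfig (Fin n))) = Set.univ :=
      Set.eq_univ_of_forall fun ω => (SimpleGraph.Reachable.refl b : (openGraph ω).Reachable b b)
    rw [h, probReal_univ]
  have hbA' : b ∈ Finset.univ.filter (fun x : Fin n => 1 - t ≤ (prodBernoulli w).real (openConn x b)) := by
    rw [Finset.mem_filter]
    refine ⟨Finset.mem_univ _, ?_⟩
    rw [hbb]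
    linarith
  have hAA' : ∀ a ∈ A, a ∈ Finset.univ.filter (fun x : Fin n => 1 - t ≤ (prodBernoulli w).real (openConn x b)) :=
    fun a ha => by
      rw [Finset.mem_filter]
      exact ⟨Finset.mem_univ _, hA a ha⟩
  have hmemA' : ∀ x ∈ Finset.univ.filter (fun x : Fin n => 1 - t ≤ (prodBernoulli w).real (openConn x b)),
      1 - t ≤ (prodBernoulli w).real (openConn x b) := fun x hx => by
    rw [Finset.mem_filter] at hx
    exact hx.2
  by_cases ho : o ∈ Finset.univ.filter (fun x : Fin n => 1 - t ≤ (prodBernoulli w).real (openConn x b))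
  · have := hmemA' o ho
    linarith
  -- main case: goodness of the level set, constant selection `b`, penalty dropped
  have hgood := good_all n w
    (Finset.univ.filter (fun x : Fin n => 1 - t ≤ (prodBernoulli w).real (openConn x b))) o b hbA' ho t
    (fun _ => b) (fun _ => hbA') hmemA'
  have hsum : 0 ≤ ∑ W ∈ (Finset.univ : Finset (Finset (Fin n))).filter (fun W => o ∈ W ∧
      Disjoint W (Finset.univ.filter (fun x : Fin n => 1 - t ≤ (prodBernoulli w).real (openConn x b)))),
        (prodBernoulli w).real {ω : BondConfig (Fin n) | openCluster ω o = (W : Set (Fin n))}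
          * (prodBernoulli w).real (openConnIn ((W : Set (Fin n))ᶜ) ((fun _ => b) W) b)ᶜ :=
    Finset.sum_nonneg fun W _ => mul_nonneg measureReal_nonneg measureReal_nonneg
  have hlive : (prodBernoulli w).real
      ((⋃ a ∈ Finset.univ.filter (fun x : Fin n => 1 - t ≤ (prodBernoulli w).real (openConn x b)),
        (openConn o a : Set (BondConfig (Fin n)))) ∩ (openConn o b)ᶜ) ≤ t := by
    linarith
  have hsub : (⋃ a ∈ A, (openConn o a : Set (BondConfig (Fin n)))) ⊆
      ((⋃ a ∈ Finset.univ.filter (fun x : Fin n => 1 - t ≤ (prodBernoulli w).real (openConn x b)),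
        (openConn o a : Set (BondConfig (Fin n)))) ∩ (openConn o b)ᶜ) ∪ openConn o b := by
    intro ω hω
    by_cases hb : ω ∈ openConn o b
    · exact Or.inr hb
    · refine Or.inl ⟨?_, hb⟩
      simp only [Set.mem_iUnion] at hω ⊢
      obtain ⟨a, ha, hωa⟩ := hω
      exact ⟨a, hAA' a ha, hωa⟩
  have hfin := (measureReal_mono (μ := prodBernoulli w) hsub).trans (measureReal_union_le _ _)
  linarith

end Summit.CriticalPhenomena.PercolationContinuityZ3.Cruxes.AdditiveGluing.SubuniformDeadPocketMaximum
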